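import Literature.Analysis.FluidPDE.OseenSchemeComplexContinuity
import HarnessLib

/-!
# The complexified Oseen scheme: the bilinear term of scheme fields is a scheme field

Analysis/FluidPDE support file (everything proved, no definitions), layer W3b-2 of the proof of
the local analyticity of bounded mild solutions in the tree's complexified Oseen scheme
(`OseenSchemeComplex.lean`: root time `m`, `m² = νt`, complex Galilean parameter `g`; operators
`freeTermC`, `duhamelC` on `schemeDomain ν T₀`; Lemarié-Rieusset 2016, Thm. 9.12, proof
pp. 260–263), used by `NSAnalyticityRadiusLinfty.lean` (Guberović 2010: analyticity radius
`√t/c₀` for bounded data) and by `NSBoundedMildAnalytic.lean`. On top of the inner-integral layer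
W3b-1 (`OseenSchemeComplexContinuity.lean`: for fields `V, W` of the class `IsSchemeField`, the
inner integral `∫ duhamelIntegrandC V W p x θ y dy` is holomorphic in `p`, jointly continuous in
`(p, x, θ)` and bounded by `C K_V K_W /(√(1-θ) Re m)`), this file performs the OUTER
`θ`-integral over `(0, 1)`:

* `integrableOn_one_sub_rpow_neg_half` — `θ ↦ (1-θ)^{-1/2}` is integrable on `(0,1)` (the
  majorant of the outer integrand);
* `exists_norm_integral_duhamelIntegrandC_le'` — the inner bound with ONE absolute constant
  `C₁ = C₁(ι)`: `‖∫ duhamelIntegrandC V W p x θ y dy‖ ≤ C₁ K_V K_W / (√(1-θ) Re m)` (and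
  integrability), repackaging `norm_integral_duhamelIntegrandC_le`;
* `differentiableOn_duhamelC` — **holomorphy of the bilinear term in the parameters**
  (holomorphy under the `θ`-integral, `Complex.differentiableOn_integral_of_dominated`, with the
  majorant `c (1-θ)^{-1/2}` on a closed ball where `Re m ≥ Re m₀/2`, `‖m‖ ≤ ‖m₀‖ + 1`);
* `continuousAt_duhamelC` — **joint continuity of the bilinear term in `(p, x)`**
  (`continuousAt_of_dominated` for the `θ`-integral);
* `exists_isSchemeField_duhamelC` — **the class `IsSchemeField` is closed under the bilinear
  term**, with the bound `C (√(νT₀)/ν) K_V K_W` of `exists_norm_duhamelC_le` (Lemarié-Rieusset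
  2016, p. 263: "`V_{k+1}` is holomorphic on `t₀ + Ω_γ`" with the bilinear `L^∞` estimate);
* `duhamelC_sub_left`, `duhamelC_sub_right`, `duhamelC_self_sub_self` — bilinearity of
  `duhamelC` on the class (the integrands are integrable), in the form used by the contraction
  step `𝓑(V,V) - 𝓑(W,W) = 𝓑(V-W, V) + 𝓑(W, V-W)` of the Picard iteration (next layer).

## Mathlib / tree search

Tree: W3b-1 (`differentiableOn_integral_duhamelIntegrandC`, `continuousAt_integral_duhamelIntegrandC`,
`norm_integral_duhamelIntegrandC_le`, `exists_closedBall_subset_schemeDomain`), W3a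
(`exists_norm_duhamelC_le`, `setLIntegral_Ioo_one_sub_rpow_neg_half`, `oseenKernelC_sub_left/right`),
W2 (`exists_norm_oseenKernelC_shift_le`), W0 (`Complex.differentiableOn_integral_of_dominated`).
Mathlib: `continuousAt_of_dominated`, `hasFiniteIntegral_iff_ofReal`, `ContinuousOn.aestronglyMeasurable`,
`integral_sub`, `integral_smul`.

## References

* P. G. Lemarié-Rieusset, *The Navier–Stokes Problem in the 21st Century*, CRC Press 2016,
  doi:10.1201/b19556, Thm. 9.12 and its proof, PDF pp. 260–263. [LemarieRieusset2016]
-/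

noncomputable section

open MeasureTheory Set Filter Metric Real
open _root_.Topology
open scoped BigOperators ENNReal

namespace Literature.Analysis.FluidPDE

open Literature.Analysis.FunctionSpaces.EuclideanSpace (complexify complexify_apply norm_complexify
  continuous_complexify)

variable {ι : Type*} [Fintype ι]

/-! ### The majorant of the outer integrand -/

/-- `θ ↦ (1-θ)^{-1/2}` is integrable on `(0, 1)` (its `∫⁻` is `2`). [folklore] -/
theorem integrableOn_one_sub_rpow_neg_half :
    IntegrableOn (fun θ : ℝ => (1 - θ) ^ (-(1 / 2 : ℝ))) (Ioo (0 : ℝ) 1) volume := by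
  have hmeas : AEStronglyMeasurable (fun θ : ℝ => (1 - θ) ^ (-(1 / 2 : ℝ)))
      ((volume : Measure ℝ).restrict (Ioo (0 : ℝ) 1)) :=
    ((measurable_const.sub measurable_id).pow_const _).aestronglyMeasurable
  refine ⟨hmeas, ?_⟩
  have hnn : 0 ≤ᵐ[(volume : Measure ℝ).restrict (Ioo (0 : ℝ) 1)]
      fun θ : ℝ => (1 - θ) ^ (-(1 / 2 : ℝ)) :=
    (ae_restrict_iff' measurableSet_Ioo).2 (Eventually.of_forall fun θ hθ =>
      Real.rpow_nonneg (by linarith [hθ.2]) _)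
  rw [hasFiniteIntegral_iff_ofReal hnn, setLIntegral_Ioo_one_sub_rpow_neg_half]
  exact ENNReal.ofNat_lt_top

/-- The scaled majorant `c (1-θ)^{-1/2}` is integrable on `(0, 1)`. [folklore] -/
theorem integrableOn_const_mul_one_sub_rpow_neg_half (c : ℝ) :
    IntegrableOn (fun θ : ℝ => c * (1 - θ) ^ (-(1 / 2 : ℝ))) (Ioo (0 : ℝ) 1) volume :=
  integrableOn_one_sub_rpow_neg_half.const_mul c

/-- `(√(1-θ) ρ)⁻¹ = ρ⁻¹ (1-θ)^{-1/2}` for `θ < 1`. [folklore] -/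
theorem inv_sqrt_one_sub_mul {θ ρ : ℝ} (hθ : θ < 1) :
    (Real.sqrt (1 - θ) * ρ)⁻¹ = ρ⁻¹ * (1 - θ) ^ (-(1 / 2 : ℝ)) := by
  rw [Real.rpow_neg (by linarith), ← Real.sqrt_eq_rpow, mul_inv, mul_comm]

/-! ### The inner bound with one absolute constant -/

section Inner

variable {ν T₀ KV KW : ℝ}
  {V W : ℂ × EuclideanSpace ℂ ι → EuclideanSpace ℝ ι → EuclideanSpace ℂ ι}

/-- **The inner integral of the bilinear term: integrability and size, with one constant**
`C₁ = C₁(ι) > 0`: for fields jointly continuous on `schemeDomain × ℝ^ι` and bounded there by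
`K_V, K_W ≥ 0`, `p ∈ schemeDomain ν T₀`, `θ ∈ (0,1)`, the integrand `duhamelIntegrandC V W p x θ ·`
is integrable and `‖∫ duhamelIntegrandC V W p x θ y dy‖ ≤ C₁ K_V K_W / (√(1-θ) Re m)`
(`norm_integral_duhamelIntegrandC_le` with the constant of `exists_norm_oseenKernelC_shift_le`).
[folklore] -/
theorem exists_norm_integral_duhamelIntegrandC_le' :
    ∃ C₁ : ℝ, 0 < C₁ ∧ ∀ {ν T₀ KV KW : ℝ}
      {V W : ℂ × EuclideanSpace ℂ ι → EuclideanSpace ℝ ι → EuclideanSpace ℂ ι},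
      0 ≤ KV → 0 ≤ KW →
      ContinuousOn (Function.uncurry V) (schemeDomain ν T₀ ×ˢ univ) →
      ContinuousOn (Function.uncurry W) (schemeDomain ν T₀ ×ˢ univ) →
      (∀ p ∈ schemeDomain ν T₀, ∀ y, ‖V p y‖ ≤ KV) → (∀ p ∈ schemeDomain ν T₀, ∀ y, ‖W p y‖ ≤ KW) →
      ∀ {p : ℂ × EuclideanSpace ℂ ι}, p ∈ schemeDomain (ι := ι) ν T₀ → ∀ (x : EuclideanSpace ℝ ι)
        {θ : ℝ}, θ ∈ Ioo (0 : ℝ) 1 →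
        Integrable (fun y => duhamelIntegrandC V W p x θ y) volume ∧
          ‖∫ y, duhamelIntegrandC V W p x θ y‖ ≤ C₁ * KV * KW / (Real.sqrt (1 - θ) * p.1.re) := by
  obtain ⟨C, hC, hK⟩ := exists_norm_oseenKernelC_shift_le (ι := ι)
  set d : ℝ := (Module.finrank ℝ (EuclideanSpace ℝ ι) : ℝ) with hd
  set M₀ : ℝ := ∫ w : EuclideanSpace ℝ ι, (1 + ‖w‖ ^ 2) ^ (-((d + 1) / 2)) with hM₀
  have he : d < 2 * ((d + 1) / 2) := by linarith
  have hM₀0 : 0 < M₀ := integral_one_add_norm_sq_rpow_neg_pos he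
  have hL : (0 : ℝ) < (25 / 6 : ℝ) ^ (-(1 / 2 : ℝ)) := Real.rpow_pos_of_pos (by norm_num) _
  refine ⟨C * M₀ * (25 / 6 : ℝ) ^ (-(1 / 2 : ℝ)), by positivity,
    fun {ν T₀ KV KW V W} hKV hKW hVc hWc hVb hWb {p} hp x {θ} hθ => ?_⟩
  exact norm_integral_duhamelIntegrandC_le hK hC.le hKV hKW hVc hWc hVb hWb hp x hθ

end Inner

/-! ### The outer integrand: measurability, holomorphy, continuity, majorant -/

section Outer

variable {ν T₀ KV KW : ℝ}
  {V W : ℂ × EuclideanSpace ℂ ι → EuclideanSpace ℝ ι → EuclideanSpace ℂ ι}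

/-- The outer integrand `θ ↦ m² ∫ duhamelIntegrandC V W p x θ y dy` is continuous on `(0, 1)` for
fields of the class (`p ∈ schemeDomain`). [folklore] -/
theorem continuousOn_outerIntegrand (hKV : 0 ≤ KV) (hKW : 0 ≤ KW)
    (hV : IsSchemeField ν T₀ KV V) (hW : IsSchemeField ν T₀ KW W)
    {p : ℂ × EuclideanSpace ℂ ι} (hp : p ∈ schemeDomain (ι := ι) ν T₀) (x : EuclideanSpace ℝ ι) :
    ContinuousOn (fun θ : ℝ => (p.1 ^ 2) • ∫ y, duhamelIntegrandC V W p x θ y) (Ioo (0 : ℝ) 1) := by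
  intro θ hθ
  have hc : Continuous fun θ : ℝ =>
      ((p, x, θ) : (ℂ × EuclideanSpace ℂ ι) × EuclideanSpace ℝ ι × ℝ) :=
    continuous_const.prodMk (continuous_const.prodMk continuous_id)
  have h : ContinuousAt (fun θ : ℝ => ∫ y, duhamelIntegrandC V W p x θ y) θ :=
    ContinuousAt.comp' (g := fun q : (ℂ × EuclideanSpace ℂ ι) × EuclideanSpace ℝ ι × ℝ =>
        ∫ y, duhamelIntegrandC V W q.1 q.2.1 q.2.2 y)
      (f := fun θ : ℝ => ((p, x, θ) : (ℂ × EuclideanSpace ℂ ι) × EuclideanSpace ℝ ι × ℝ))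
      (x := θ) (continuousAt_integral_duhamelIntegrandC hKV hKW hV hW hp x hθ) hc.continuousAt
  exact (h.const_smul (p.1 ^ 2)).continuousWithinAt

/-- The outer integrand is a.e. strongly measurable on `(0, 1)`. [folklore] -/
theorem aestronglyMeasurable_outerIntegrand (hKV : 0 ≤ KV) (hKW : 0 ≤ KW)
    (hV : IsSchemeField ν T₀ KV V) (hW : IsSchemeField ν T₀ KW W)
    {p : ℂ × EuclideanSpace ℂ ι} (hp : p ∈ schemeDomain (ι := ι) ν T₀) (x : EuclideanSpace ℝ ι) :
    AEStronglyMeasurable (fun θ : ℝ => (p.1 ^ 2) • ∫ y, duhamelIntegrandC V W p x θ y)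
      ((volume : Measure ℝ).restrict (Ioo (0 : ℝ) 1)) :=
  (continuousOn_outerIntegrand hKV hKW hV hW hp x).aestronglyMeasurable measurableSet_Ioo

/-- **The majorant of the outer integrand on a closed ball of parameters**: if on
`closedBall p₀ δ ⊆ schemeDomain` one has `Re m ≥ Re m₀/2` and `‖m‖ ≤ ‖m₀‖ + 1`, then for `p` in the
ball, `θ ∈ (0,1)` and every `x`,
`‖m² ∫ duhamelIntegrandC V W p x θ y dy‖ ≤ (‖m₀‖+1)² C₁ K_V K_W (Re m₀/2)⁻¹ (1-θ)^{-1/2}`. [folklore] -/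
theorem norm_outerIntegrand_le_of_mem_closedBall {C₁ : ℝ}
    (hC₁ : ∀ {p : ℂ × EuclideanSpace ℂ ι}, p ∈ schemeDomain (ι := ι) ν T₀ → ∀ (x : EuclideanSpace ℝ ι)
      {θ : ℝ}, θ ∈ Ioo (0 : ℝ) 1 →
        ‖∫ y, duhamelIntegrandC V W p x θ y‖ ≤ C₁ * KV * KW / (Real.sqrt (1 - θ) * p.1.re))
    (hC₁0 : 0 ≤ C₁ * KV * KW)
    {p₀ : ℂ × EuclideanSpace ℂ ι} (hp₀ : p₀ ∈ schemeDomain (ι := ι) ν T₀) {δ : ℝ}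
    (hδD : closedBall p₀ δ ⊆ schemeDomain ν T₀)
    (hδb : ∀ p ∈ closedBall p₀ δ, p₀.1.re / 2 ≤ p.1.re ∧ ‖p.1‖ ≤ ‖p₀.1‖ + 1)
    {p : ℂ × EuclideanSpace ℂ ι} (hp : p ∈ closedBall p₀ δ) (x : EuclideanSpace ℝ ι)
    {θ : ℝ} (hθ : θ ∈ Ioo (0 : ℝ) 1) :
    ‖(p.1 ^ 2) • ∫ y, duhamelIntegrandC V W p x θ y‖ ≤
      (‖p₀.1‖ + 1) ^ 2 * (C₁ * KV * KW) * (p₀.1.re / 2)⁻¹ * (1 - θ) ^ (-(1 / 2 : ℝ)) := by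
  have hρ₀ : 0 < p₀.1.re := hp₀.1
  obtain ⟨hre, hnm⟩ := hδb p hp
  have hre0 : 0 < p.1.re := (half_pos hρ₀).trans_le hre
  have h1θ : 0 < 1 - θ := by linarith [hθ.2]
  have hs : 0 < Real.sqrt (1 - θ) := Real.sqrt_pos.2 h1θ
  have h := hC₁ (hδD hp) x hθ
  rw [norm_smul, norm_pow]
  have hfrac : C₁ * KV * KW / (Real.sqrt (1 - θ) * p.1.re) ≤
      (C₁ * KV * KW) * (p₀.1.re / 2)⁻¹ * (1 - θ) ^ (-(1 / 2 : ℝ)) := by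
    rw [div_eq_mul_inv, inv_sqrt_one_sub_mul hθ.2, ← mul_assoc]
    have hinv : p.1.re⁻¹ ≤ (p₀.1.re / 2)⁻¹ := by
      rw [inv_le_inv₀ hre0 (half_pos hρ₀)]; exact hre
    have hpw : 0 ≤ (1 - θ) ^ (-(1 / 2 : ℝ)) := Real.rpow_nonneg h1θ.le _
    gcongr
  calc ‖p.1‖ ^ 2 * ‖∫ y, duhamelIntegrandC V W p x θ y‖
      ≤ (‖p₀.1‖ + 1) ^ 2 * ((C₁ * KV * KW) * (p₀.1.re / 2)⁻¹ * (1 - θ) ^ (-(1 / 2 : ℝ))) := by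
        refine mul_le_mul (pow_le_pow_left₀ (norm_nonneg _) hnm 2) (h.trans hfrac) (norm_nonneg _)
          (by positivity)
    _ = _ := by ring

/-- **Holomorphy of the bilinear term in the parameters** (Lemarié-Rieusset 2016, proof of
Thm. 9.12, p. 263: "`V_{k+1}` is holomorphic on `t₀ + Ω_γ`"): for fields `V, W` of the class,
`p ↦ duhamelC ν V W p x` is complex differentiable on `schemeDomain ν T₀` for every `x`
(holomorphy under the `θ`-integral sign with the majorant `c (1-θ)^{-1/2}` on closed balls of
parameters; the inner integral is holomorphic by `differentiableOn_integral_duhamelIntegrandC`).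
[cite: LemarieRieusset2016, Thm. 9.12 (proof, p. 263)] -/
theorem differentiableOn_duhamelC (hKV : 0 ≤ KV) (hKW : 0 ≤ KW)
    (hV : IsSchemeField ν T₀ KV V) (hW : IsSchemeField ν T₀ KW W) (x : EuclideanSpace ℝ ι) :
    DifferentiableOn ℂ (fun p => duhamelC ν V W p x) (schemeDomain (ι := ι) ν T₀) := by
  obtain ⟨C₁, hC₁, hI⟩ := exists_norm_integral_duhamelIntegrandC_le' (ι := ι)
  have hI' : ∀ {p : ℂ × EuclideanSpace ℂ ι}, p ∈ schemeDomain (ι := ι) ν T₀ →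
      ∀ (x : EuclideanSpace ℝ ι) {θ : ℝ}, θ ∈ Ioo (0 : ℝ) 1 →
        ‖∫ y, duhamelIntegrandC V W p x θ y‖ ≤ C₁ * KV * KW / (Real.sqrt (1 - θ) * p.1.re) :=
    fun hp x θ hθ => (hI hKV hKW hV.continuousOn hW.continuousOn hV.norm_le hW.norm_le hp x hθ).2
  simp only [duhamelC_eq]
  refine DifferentiableOn.const_smul (c := ((ν : ℂ))⁻¹) ?_
  refine Complex.differentiableOn_integral_of_dominated
    (fun p hp => aestronglyMeasurable_outerIntegrand hKV hKW hV hW hp x) ?_ ?_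
  · refine (ae_restrict_iff' measurableSet_Ioo).2 (Eventually.of_forall fun θ hθ => ?_)
    exact ((differentiableOn_fst (𝕜 := ℂ) (s := schemeDomain (ι := ι) ν T₀)).pow 2).smul
      (differentiableOn_integral_duhamelIntegrandC hKV hKW hV hW x hθ)
  · intro p₀ hp₀
    obtain ⟨δ, hδ, hδD, hδb⟩ := exists_closedBall_subset_schemeDomain hp₀
    have hc0 : 0 ≤ C₁ * KV * KW := by positivity
    refine ⟨δ, hδ, ball_subset_closedBall.trans hδD,
      fun θ => (‖p₀.1‖ + 1) ^ 2 * (C₁ * KV * KW) * (p₀.1.re / 2)⁻¹ * (1 - θ) ^ (-(1 / 2 : ℝ)),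
      integrableOn_const_mul_one_sub_rpow_neg_half _, ?_⟩
    refine (ae_restrict_iff' measurableSet_Ioo).2 (Eventually.of_forall fun θ hθ p hp => ?_)
    exact norm_outerIntegrand_le_of_mem_closedBall hI' hc0 hp₀ hδD hδb (ball_subset_closedBall hp) x hθ

/-- **Joint continuity of the bilinear term in `(p, x)`** at every point with `p ∈ schemeDomain`
(dominated convergence in the `θ`-integral: the outer integrand is jointly continuous in
`(p, x, θ)` by `continuousAt_integral_duhamelIntegrandC` and bears the majorant `c (1-θ)^{-1/2}`
near `p₀`). [folklore] -/
theorem continuousAt_duhamelC (hKV : 0 ≤ KV) (hKW : 0 ≤ KW)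
    (hV : IsSchemeField ν T₀ KV V) (hW : IsSchemeField ν T₀ KW W)
    {p₀ : ℂ × EuclideanSpace ℂ ι} (hp₀ : p₀ ∈ schemeDomain (ι := ι) ν T₀) (x₀ : EuclideanSpace ℝ ι) :
    ContinuousAt (fun q : (ℂ × EuclideanSpace ℂ ι) × EuclideanSpace ℝ ι => duhamelC ν V W q.1 q.2)
      (p₀, x₀) := by
  obtain ⟨C₁, hC₁, hI⟩ := exists_norm_integral_duhamelIntegrandC_le' (ι := ι)
  have hI' : ∀ {p : ℂ × EuclideanSpace ℂ ι}, p ∈ schemeDomain (ι := ι) ν T₀ →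
      ∀ (x : EuclideanSpace ℝ ι) {θ : ℝ}, θ ∈ Ioo (0 : ℝ) 1 →
        ‖∫ y, duhamelIntegrandC V W p x θ y‖ ≤ C₁ * KV * KW / (Real.sqrt (1 - θ) * p.1.re) :=
    fun hp x θ hθ => (hI hKV hKW hV.continuousOn hW.continuousOn hV.norm_le hW.norm_le hp x hθ).2
  obtain ⟨δ, hδ, hδD, hδb⟩ := exists_closedBall_subset_schemeDomain hp₀
  have hc0 : 0 ≤ C₁ * KV * KW := by positivity
  simp only [duhamelC_eq]
  refine ContinuousAt.const_smul (c := ((ν : ℂ))⁻¹) ?_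
  -- the neighbourhood: `p ∈ closedBall p₀ δ`
  have hnhds : ∀ᶠ q : (ℂ × EuclideanSpace ℂ ι) × EuclideanSpace ℝ ι in 𝓝 (p₀, x₀),
      q.1 ∈ closedBall p₀ δ :=
    (continuous_fst.tendsto _).eventually (closedBall_mem_nhds p₀ hδ)
  refine continuousAt_of_dominated ?_ ?_ ?_ ?_
    (bound := fun θ => (‖p₀.1‖ + 1) ^ 2 * (C₁ * KV * KW) * (p₀.1.re / 2)⁻¹ * (1 - θ) ^ (-(1 / 2 : ℝ)))
  · filter_upwards [hnhds] with q hq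
    exact aestronglyMeasurable_outerIntegrand hKV hKW hV hW (hδD hq) q.2
  · filter_upwards [hnhds] with q hq
    exact (ae_restrict_iff' measurableSet_Ioo).2 (Eventually.of_forall fun θ hθ =>
      norm_outerIntegrand_le_of_mem_closedBall hI' hc0 hp₀ hδD hδb hq q.2 hθ)
  · exact integrableOn_const_mul_one_sub_rpow_neg_half _
  · refine (ae_restrict_iff' measurableSet_Ioo).2 (Eventually.of_forall fun θ hθ => ?_)
    have hc : Continuous fun q : (ℂ × EuclideanSpace ℂ ι) × EuclideanSpace ℝ ι =>
        ((q.1, q.2, θ) : (ℂ × EuclideanSpace ℂ ι) × EuclideanSpace ℝ ι × ℝ) :=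
      continuous_fst.prodMk (continuous_snd.prodMk continuous_const)
    have h : ContinuousAt (fun q : (ℂ × EuclideanSpace ℂ ι) × EuclideanSpace ℝ ι =>
        ∫ y, duhamelIntegrandC V W q.1 q.2 θ y) (p₀, x₀) :=
      ContinuousAt.comp' (g := fun r : (ℂ × EuclideanSpace ℂ ι) × EuclideanSpace ℝ ι × ℝ =>
          ∫ y, duhamelIntegrandC V W r.1 r.2.1 r.2.2 y)
        (f := fun q : (ℂ × EuclideanSpace ℂ ι) × EuclideanSpace ℝ ι =>
          ((q.1, q.2, θ) : (ℂ × EuclideanSpace ℂ ι) × EuclideanSpace ℝ ι × ℝ))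
        (x := (p₀, x₀)) (continuousAt_integral_duhamelIntegrandC hKV hKW hV hW hp₀ x₀ hθ) hc.continuousAt
    have hm : ContinuousAt (fun q : (ℂ × EuclideanSpace ℂ ι) × EuclideanSpace ℝ ι => q.1.1 ^ 2)
        (p₀, x₀) := by fun_prop
    exact hm.smul h

/-- **The class `IsSchemeField` is closed under the bilinear term** (Lemarié-Rieusset 2016, proof
of Thm. 9.12, p. 263: holomorphy of `V_{k+1}` on the cone and the bilinear `L^∞` estimate with the
factor `√(Re τ - t₀)`): there is `C = C(ι) > 0` such that for `ν > 0` and fields `V, W` of the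
class with bounds `K_V, K_W ≥ 0` on `schemeDomain ν T₀`, `duhamelC ν V W` is of the class with
bound `C (√(νT₀)/ν) K_V K_W`. [cite: LemarieRieusset2016, Thm. 9.12 (proof, p. 263)] -/
theorem exists_isSchemeField_duhamelC :
    ∃ C : ℝ, 0 < C ∧ ∀ {ν T₀ : ℝ}, 0 < ν →
      ∀ {V W : ℂ × EuclideanSpace ℂ ι → EuclideanSpace ℝ ι → EuclideanSpace ℂ ι} {KV KW : ℝ},
        0 ≤ KV → 0 ≤ KW → IsSchemeField ν T₀ KV V → IsSchemeField ν T₀ KW W →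
        IsSchemeField ν T₀ (C * (Real.sqrt (ν * T₀) / ν) * KV * KW) (duhamelC ν V W) := by
  obtain ⟨C, hC, hB⟩ := exists_norm_duhamelC_le (ι := ι)
  refine ⟨3 * C, by positivity, fun {ν T₀} hν {V W KV KW} hKV hKW hV hW => ⟨?_, ?_, ?_⟩⟩
  · intro q hq
    obtain ⟨hp, -⟩ := mem_prod.1 hq
    exact (continuousAt_duhamelC hKV hKW hV hW hp q.2).continuousWithinAt
  · intro p hp x
    have h := hB hν hKV hKW hV.norm_le hW.norm_le p hp x
    calc _ ≤ _ := h
      _ = 3 * C * (Real.sqrt (ν * T₀) / ν) * KV * KW := by ring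
  · exact fun x => differentiableOn_duhamelC hKV hKW hV hW x

end Outer

/-! ### Bilinearity of the bilinear term on the class -/

section Bilinear

variable {ν T₀ KV KV' KW : ℝ}
  {V V' W : ℂ × EuclideanSpace ℂ ι → EuclideanSpace ℝ ι → EuclideanSpace ℂ ι}

/-- The integrand is additive in the first field, pointwise. [folklore] -/
theorem duhamelIntegrandC_sub_left (V V' W : ℂ × EuclideanSpace ℂ ι → EuclideanSpace ℝ ι → EuclideanSpace ℂ ι)
    (p : ℂ × EuclideanSpace ℂ ι) (x : EuclideanSpace ℝ ι) (θ : ℝ) (y : EuclideanSpace ℝ ι) :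
    duhamelIntegrandC (fun q z => V q z - V' q z) W p x θ y =
      duhamelIntegrandC V W p x θ y - duhamelIntegrandC V' W p x θ y := by
  simp only [duhamelIntegrandC, oseenKernelC_sub_left]

/-- The integrand is additive in the second field, pointwise. [folklore] -/
theorem duhamelIntegrandC_sub_right (V W W' : ℂ × EuclideanSpace ℂ ι → EuclideanSpace ℝ ι → EuclideanSpace ℂ ι)
    (p : ℂ × EuclideanSpace ℂ ι) (x : EuclideanSpace ℝ ι) (θ : ℝ) (y : EuclideanSpace ℝ ι) :
    duhamelIntegrandC V (fun q z => W q z - W' q z) p x θ y =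
      duhamelIntegrandC V W p x θ y - duhamelIntegrandC V W' p x θ y := by
  simp only [duhamelIntegrandC, oseenKernelC_sub_right]

/-- **Integrability of the outer integrand on `(0,1)`** for fields of the class
(`p ∈ schemeDomain`): measurable by continuity, dominated by `c (1-θ)^{-1/2}`. [folklore] -/
theorem integrableOn_outerIntegrand (hKV : 0 ≤ KV) (hKW : 0 ≤ KW)
    (hV : IsSchemeField ν T₀ KV V) (hW : IsSchemeField ν T₀ KW W)
    {p : ℂ × EuclideanSpace ℂ ι} (hp : p ∈ schemeDomain (ι := ι) ν T₀) (x : EuclideanSpace ℝ ι) :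
    IntegrableOn (fun θ : ℝ => (p.1 ^ 2) • ∫ y, duhamelIntegrandC V W p x θ y) (Ioo (0 : ℝ) 1)
      volume := by
  obtain ⟨C₁, hC₁, hI⟩ := exists_norm_integral_duhamelIntegrandC_le' (ι := ι)
  have hI' : ∀ {p : ℂ × EuclideanSpace ℂ ι}, p ∈ schemeDomain (ι := ι) ν T₀ →
      ∀ (x : EuclideanSpace ℝ ι) {θ : ℝ}, θ ∈ Ioo (0 : ℝ) 1 →
        ‖∫ y, duhamelIntegrandC V W p x θ y‖ ≤ C₁ * KV * KW / (Real.sqrt (1 - θ) * p.1.re) :=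
    fun hp x θ hθ => (hI hKV hKW hV.continuousOn hW.continuousOn hV.norm_le hW.norm_le hp x hθ).2
  obtain ⟨δ, hδ, hδD, hδb⟩ := exists_closedBall_subset_schemeDomain hp
  have hc0 : 0 ≤ C₁ * KV * KW := by positivity
  refine Integrable.mono' (integrableOn_const_mul_one_sub_rpow_neg_half
      ((‖p.1‖ + 1) ^ 2 * (C₁ * KV * KW) * (p.1.re / 2)⁻¹))
    (aestronglyMeasurable_outerIntegrand hKV hKW hV hW hp x) ?_
  refine (ae_restrict_iff' measurableSet_Ioo).2 (Eventually.of_forall fun θ hθ => ?_)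
  have h := norm_outerIntegrand_le_of_mem_closedBall hI' hc0 hp hδD hδb (mem_closedBall_self hδ.le) x hθ
  simpa only [mul_assoc] using h

/-- **The bilinear term respects subtraction in the first field** on the domain, for fields of
the class. [folklore] -/
theorem duhamelC_sub_left (hKV : 0 ≤ KV) (hKV' : 0 ≤ KV') (hKW : 0 ≤ KW)
    (hV : IsSchemeField ν T₀ KV V) (hV' : IsSchemeField ν T₀ KV' V') (hW : IsSchemeField ν T₀ KW W)
    {p : ℂ × EuclideanSpace ℂ ι} (hp : p ∈ schemeDomain (ι := ι) ν T₀) (x : EuclideanSpace ℝ ι) :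
    duhamelC ν (fun q z => V q z - V' q z) W p x = duhamelC ν V W p x - duhamelC ν V' W p x := by
  obtain ⟨C₁, hC₁, hI⟩ := exists_norm_integral_duhamelIntegrandC_le' (ι := ι)
  simp only [duhamelC_eq]
  rw [← smul_sub, ← integral_sub (integrableOn_outerIntegrand hKV hKW hV hW hp x)
    (integrableOn_outerIntegrand hKV' hKW hV' hW hp x)]
  congr 1
  refine setIntegral_congr_fun measurableSet_Ioo fun θ hθ => ?_
  rw [← smul_sub, ← integral_sub
    (hI hKV hKW hV.continuousOn hW.continuousOn hV.norm_le hW.norm_le hp x hθ).1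
    (hI hKV' hKW hV'.continuousOn hW.continuousOn hV'.norm_le hW.norm_le hp x hθ).1]
  congr 1
  refine integral_congr_ae (Eventually.of_forall fun y => ?_)
  exact duhamelIntegrandC_sub_left V V' W p x θ y

/-- **The bilinear term respects subtraction in the second field** on the domain, for fields of
the class. [folklore] -/
theorem duhamelC_sub_right (hKV : 0 ≤ KV) (hKW : 0 ≤ KW) (hKV' : 0 ≤ KV')
    (hV : IsSchemeField ν T₀ KV V) (hW : IsSchemeField ν T₀ KW W) (hW' : IsSchemeField ν T₀ KV' V')
    {p : ℂ × EuclideanSpace ℂ ι} (hp : p ∈ schemeDomain (ι := ι) ν T₀) (x : EuclideanSpace ℝ ι) :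
    duhamelC ν V (fun q z => W q z - V' q z) p x = duhamelC ν V W p x - duhamelC ν V V' p x := by
  obtain ⟨C₁, hC₁, hI⟩ := exists_norm_integral_duhamelIntegrandC_le' (ι := ι)
  simp only [duhamelC_eq]
  rw [← smul_sub, ← integral_sub (integrableOn_outerIntegrand hKV hKW hV hW hp x)
    (integrableOn_outerIntegrand hKV hKV' hV hW' hp x)]
  congr 1
  refine setIntegral_congr_fun measurableSet_Ioo fun θ hθ => ?_
  rw [← smul_sub, ← integral_sub
    (hI hKV hKW hV.continuousOn hW.continuousOn hV.norm_le hW.norm_le hp x hθ).1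
    (hI hKV hKV' hV.continuousOn hW'.continuousOn hV.norm_le hW'.norm_le hp x hθ).1]
  congr 1
  refine integral_congr_ae (Eventually.of_forall fun y => ?_)
  exact duhamelIntegrandC_sub_right V W V' p x θ y

/-- **The splitting of the quadratic increment** (the contraction step of the Picard iteration,
Lemarié-Rieusset 2016, proof of Thm. 5.1 / Thm. 9.12): for fields `V, W` of the class and
`p ∈ schemeDomain`,
`duhamelC ν V V p x - duhamelC ν W W p x = duhamelC ν (V - W) V p x + duhamelC ν W (V - W) p x`.
[folklore] -/
theorem duhamelC_self_sub_self (hKV : 0 ≤ KV) (hKW : 0 ≤ KW)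
    (hV : IsSchemeField ν T₀ KV V) (hW : IsSchemeField ν T₀ KW W)
    {p : ℂ × EuclideanSpace ℂ ι} (hp : p ∈ schemeDomain (ι := ι) ν T₀) (x : EuclideanSpace ℝ ι) :
    duhamelC ν V V p x - duhamelC ν W W p x =
      duhamelC ν (fun q z => V q z - W q z) V p x + duhamelC ν W (fun q z => V q z - W q z) p x := by
  rw [duhamelC_sub_left hKV hKW hKV hV hW hV hp x, duhamelC_sub_right hKW hKV hKW hW hV hW hp x]
  abel

end Bilinear

end Literature.Analysis.FluidPDE

end
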